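import Summits.ResolutionOfSingularities.ResolutionOfSingularities.Theorems.WeightedInvariantPointDrop
import Summits.ResolutionOfSingularities.ResolutionOfSingularities.Theorems.WeightedInvariantIota3JFlatOver
import Summits.ResolutionOfSingularities.ResolutionOfSingularities.Theorems.WeightedInvariantIota3TauStrat
import HarnessLib

/-!
# `J₃ᵗ` and (P3t-drop) OF RECORD (IOTA3-DESIGN v1.3 §8.3/§8.4): `jFlatT := jFlatOver iotaOrdEpsTau`, `P3tDropOf` / `P3tDrop` / `P3PointDrop`
# (door `HypersurfaceCentreConstruction`, stmt-ResolutionOfSingularities-19897; P3 rung `stub_keyRungLE_three`, skeleton v3.8;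
# ORDERS (o37) sequel + (o33-b)/(P3t-drop) of res-L1-w43-plan-1, RULING gen 11 #4 (7) NAMES OF RECORD; typer res-type-061)

Topic: `Summits/ResolutionOfSingularities/ResolutionOfSingularities/Theorems`. STATEMENT MODULE (definitions by one-line instantiation of the
parametric objects already in the tree + trivial seams; NO proof of any drop).  With res-type-013's τ letter in the tree
(`Iota3.iotaOrdEpsTau = iotaLex ω iotaOrdEps iotaTau`, `Iota3.iotaFlatT`, `…Iota3Tau.lean` p532999; (strat-τ) `…Iota3TauStrat.lean` p534291) and res-type-092's tie predicate
(`Iota3.IsTiePosition`, `…Iota3Tie.lean`), the v1.3 objects of record are instances of `jFlatOver` (p531207) and `PointDropOf` (p532360):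

* **`Iota3.jFlatT := jFlatOver iotaOrdEpsTau`** — THE CENTRE RULE OF RECORD v1.3 §8.3 (`J₃ᵗ = jCylinder ι₀ jFlatCoreE`, ι₀ = (ν ; ε ; τ));
  `jFlatT_isoInvariant` / `jFlatT_unitInvariant` ((c5)/(c12-J) by `jFlatOver_isoInvariant iotaOrdEpsTau_isoInvariant`);
  `jFlatOver_congr` (two stratifiers with the same generic prime of the top stratum give the same rule); regimes (hypotheses explicit —
  res-type-013's (o40) 2/2 `topStratumPrime_iotaOrdEpsTau_eq_maximalIdeal_of_isTiePosition` / `…_eq_of_not_isTiePosition` discharge them):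
  `jFlatT_eq_jSigmaPt` (dimension-3 ε ≠ 1 point position of (ν ; ε ; τ) — ISOLATED or TIE — ⇒ exact σ-flag point centre),
  `jFlatT_eq_jContact_of_eps_eq_one` / `_of_dim_le_two`, `jFlatT_eq_cylinderAt_jContact`, `jFlatT_eq_jFlatE_of_topStratumPrime_eq` (off tie
  positions `J₃ᵗ` is the ε-switched rule over (ν ; ε)), `flagContactFiltration_le_jFlatT`; and from `IsTiePosition` directly (013's (o40) 2/2
  `…Iota3TauStrat`): `jFlatT_eq_jSigmaPt_of_isTiePosition`, `jFlatT_eq_jFlatE_of_not_isTiePosition`, `flagContactFiltration_le_jFlatT_of_isTiePosition`.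
* **`Iota3.P3tDropOf Tame ι p := PointDropOf (fun R _ _ f => IsTiePosition R f) Tame ι p`**, **`P3tDrop Tame p := P3tDropOf Tame iotaFlatT p`**,
  `P3tDropWeightTame p := P3tDrop (WeightTame p) p` — (P3t-drop) OF RECORD (RULING gen 11 #4 (7): «(P3t-drop) :=
  `PointDropOf (fun R _ _ f => IsTiePosition R f) WeightTame iotaFlatT p`», `p3tDropWeightTame_iff`).
* **`Iota3.P3PointDrop Tame p := PointDropOf (fun R _ _ f => IsIsolatedPosition R f ∨ IsTiePosition R f) Tame iotaFlatT p`** — the (o42)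
  TARGET «tame point-centre drop» (DEALS gen 11 #2), `= P3bDropOf Tame iotaFlatT p ∧ P3tDrop Tame p` (`p3PointDrop_iff`).
* seams `P3tDropOf.mono_tame/.drop`, `P3tDrop.mono_tame/.centre_le_jFlatT`, `P3PointDrop.mono_tame/.p3bDropOf/.p3tDrop/.of_rows`.

[OURS · candidates · conjecture-grade statements of OUR key's rung; nothing here asserts anything about Hironaka's problem; NOT a statement of the
manuscript under review (Hironaka 2017, [claim: Hironaka2017, status: under-review]); AI typing, weaker than expert review.]
-/

noncomputable section

open IsLocalRing Literature.AlgebraicGeometry.Resolution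
open Summit.ResolutionOfSingularities.ResolutionOfSingularities.Theorems

set_option linter.dupNamespace false -- mandated namespace of this single-conjunct summit

namespace Summit.ResolutionOfSingularities.ResolutionOfSingularities.Cruxes.HypersurfaceCentreConstruction.LocalEngine

namespace Iota3

/-! ## `J₃ᵗ` of record -/

/-- [OURS · (o37) v1.3 §8.3 · candidate · OF RECORD] **`J₃ᵗ := jFlatOver iotaOrdEpsTau`**: the cylinder construction over the top
`(ν ; ε ; τ)`-stratum of the ε-switched core (`jContact` at `dim ≤ 2` or `ε = 1`, the exact σ-flag weights `jSigmaPt` otherwise). -/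
def jFlatT : (R : Type) → [CommRing R] → R → ℕ → Ideal R :=
  jFlatOver iotaOrdEpsTau

/-- `jFlatT` unfolded. [folklore] -/
theorem jFlatT_def (R : Type) [CommRing R] (f : R) (m : ℕ) : jFlatT R f m = jFlatOver iotaOrdEpsTau R f m := rfl

/-- **(c5) `JIsoInvariant jFlatT`.** [OURS · (o37) v1.3] -/
theorem jFlatT_isoInvariant : JIsoInvariant jFlatT := jFlatOver_isoInvariant iotaOrdEpsTau_isoInvariant

/-- **(c12-J) `JUnitInvariant jFlatT`.** [OURS · (o37) v1.3] -/
theorem jFlatT_unitInvariant : JUnitInvariant jFlatT := jFlatOver_unitInvariant iotaOrdEpsTau_unitInvariant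

/-- Two stratifiers with the same generic prime of the top stratum at `(R, f)` give the same rule at `(R, f)`. [folklore] -/
theorem jFlatOver_congr {ι₀ ι₀' : (R : Type) → [CommRing R] → R → Ordinal.{0}} (R : Type) [CommRing R] (f : R)
    (h : ContactCylinder.topStratumPrime ι₀ R f = ContactCylinder.topStratumPrime ι₀' R f) (m : ℕ) :
    jFlatOver ι₀ R f m = jFlatOver ι₀' R f m := by
  rw [jFlatOver_def, jFlatOver_def, ContactCylinder.jCylinder_eq_dite ι₀ jFlatCoreE R f m h,
    ContactCylinder.jCylinder_eq_dite ι₀' jFlatCoreE R f m rfl]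

/-- **TIE regime** (hypotheses explicit; res-type-013's (o40) 2/2 supplies them from `IsTiePosition R f`:
`topStratumPrime_iotaOrdEpsTau_eq_maximalIdeal_of_isTiePosition`, `ringKrullDim R = 3`, `iotaEps R f = 0`): at a point-centre position of the
stratifier `(ν ; ε ; τ)` of dimension 3 with `ε ≠ 1`, `J₃ᵗ` is the exact σ-flag point centre `jSigmaPt`. [OURS · (o37) v1.3 §8.4 row TIE] -/
theorem jFlatT_eq_jSigmaPt (R : Type) [CommRing R] [IsLocalRing R] (f : R) (m : ℕ)
    (h : ContactCylinder.topStratumPrime iotaOrdEpsTau R f = maximalIdeal R) (hdim : ¬ ringKrullDim R ≤ 2) (hε : iotaEps R f ≠ 1) :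
    jFlatT R f m = jSigmaPt R f m :=
  jFlatOver_eq_jSigmaPt iotaOrdEpsTau R f m h hdim hε

/-- **CROSSING regime read over `(ν ; ε ; τ)`**: point-centre position with `ε = 1` ⇒ `J₃ᵗ = jContact`. [OURS · (o37) v1.3 §8.4 row CROSSING] -/
theorem jFlatT_eq_jContact_of_eps_eq_one (R : Type) [CommRing R] [IsLocalRing R] (f : R) (m : ℕ)
    (h : ContactCylinder.topStratumPrime iotaOrdEpsTau R f = maximalIdeal R) (hε : iotaEps R f = 1) : jFlatT R f m = jContact R f m :=
  jFlatOver_eq_jContact_of_eps_eq_one iotaOrdEpsTau R f m h hε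

/-- **Dimension ≤ 2 read over `(ν ; ε ; τ)`**: point-centre position of dimension `≤ 2` ⇒ `J₃ᵗ = jContact`. [OURS · (o37) v1.3 §8.4 row P≤2] -/
theorem jFlatT_eq_jContact_of_dim_le_two (R : Type) [CommRing R] [IsLocalRing R] (f : R) (m : ℕ)
    (h : ContactCylinder.topStratumPrime iotaOrdEpsTau R f = maximalIdeal R) (hdim : ringKrullDim R ≤ 2) : jFlatT R f m = jContact R f m :=
  jFlatOver_eq_jContact_of_dim_le_two iotaOrdEpsTau R f m h hdim

/-- **CYLINDER regimes read over `(ν ; ε ; τ)`**: when the top `(ν ; ε ; τ)`-stratum is `V(P)` with `dim R_P ≤ 2`, `J₃ᵗ` is the cylinder over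
`P` of `jContact`. [OURS · (o37) v1.3 §8.4 rows CURVE° / DIV] -/
theorem jFlatT_eq_cylinderAt_jContact (R : Type) [CommRing R] (f : R) (m : ℕ) {P : Ideal R} [P.IsPrime]
    (hE : ContactCylinder.topStratum iotaOrdEpsTau R f = {𝔮 | P ≤ 𝔮.asIdeal}) (hdim : ringKrullDim (Localization.AtPrime P) ≤ 2) :
    jFlatT R f m = ContactCylinder.cylinderAt jContact R P f m :=
  jFlatOver_eq_cylinderAt_jContact iotaOrdEpsTau R f m hE hdim

/-- **Off tie positions** the τ letter does not move the generic prime of the top stratum (res-type-013's (o40) 2/2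
`topStratumPrime_iotaOrdEpsTau_eq_of_not_isTiePosition`, dimension ≤ 3), and then `J₃ᵗ = jFlatE` (the ε-switched rule over (ν ; ε)); stated
here with that equality as the hypothesis. [OURS · (o37) v1.3 §8.4] -/
theorem jFlatT_eq_jFlatE_of_topStratumPrime_eq (R : Type) [CommRing R] (f : R)
    (h : ContactCylinder.topStratumPrime iotaOrdEpsTau R f = ContactCylinder.topStratumPrime iotaOrdEps R f) (m : ℕ) :
    jFlatT R f m = jFlatE R f m :=
  jFlatOver_congr R f h m

/-- An attaining flag's filtration lies in `J₃ᵗ` at a dimension-3, ε ≠ 1 point-centre position of `(ν ; ε ; τ)` ((adm)-shape of the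
(P3b)/(P3t-drop) centre). [OURS · (o37) v1.3] -/
theorem flagContactFiltration_le_jFlatT (R : Type) [CommRing R] [IsLocalRing R] {f : R} (hf0 : f ≠ 0) (hfu : ¬ IsUnit f)
    (h : ContactCylinder.topStratumPrime iotaOrdEpsTau R f = maximalIdeal R) (hdim : ¬ ringKrullDim R ≤ 2) (hε : iotaEps R f ≠ 1)
    {g₁ g₂ : R} {q r₁ r₂ : ℕ} (hmax : IsSigmaMaximiser f (adicOrder f).toNat g₁ g₂ q r₁ r₂) (hprim : IsPrimitiveTriple q r₁ r₂) (m : ℕ) :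
    flagContactFiltration g₁ g₂ q r₁ r₂ m ≤ jFlatT R f m :=
  flagContactFiltration_le_jFlatOver iotaOrdEpsTau R hf0 hfu h hdim hε hmax hprim m

/-! ## The same regimes from `IsTiePosition` (res-type-013's (o40) 2/2 `…Iota3TauStrat`) -/

/-- `(3 : WithBot ℕ∞) ≤ 2` is false: a ring of Krull dimension `3` does not have dimension `≤ 2`. [folklore] -/
theorem not_ringKrullDim_le_two_of_eq_three {R : Type} [CommRing R] (h : ringKrullDim R = 3) : ¬ ringKrullDim R ≤ 2 := by
  rw [h]
  decide

/-- **TIE regime**: at a tie position (`[IsLocalRing R]` is any local structure — e.g. the one of `h.isRegularLocalRing`) `J₃ᵗ` is the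
exact σ-flag point centre `jSigmaPt`. [OURS · (o37) v1.3 §8.4 row TIE] -/
theorem jFlatT_eq_jSigmaPt_of_isTiePosition (R : Type) [CommRing R] [IsLocalRing R] {f : R} (h : IsTiePosition R f) (m : ℕ) :
    jFlatT R f m = jSigmaPt R f m := by
  refine jFlatT_eq_jSigmaPt R f m (topStratumPrime_iotaOrdEpsTau_eq_maximalIdeal_of_isTiePosition h)
    (not_ringKrullDim_le_two_of_eq_three (ringKrullDim_eq_three_of_isTiePosition h)) ?_
  obtain ⟨_, -, hε, -, -⟩ := h
  rw [hε]
  exact zero_ne_one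

/-- **Off tie positions** (local Noetherian, Krull dimension `≤ 3`) `J₃ᵗ = jFlatE`. [OURS · (o37) v1.3 §8.4] -/
theorem jFlatT_eq_jFlatE_of_not_isTiePosition (R : Type) [CommRing R] [IsLocalRing R] [IsNoetherianRing R]
    (hdim : ringKrullDim R ≤ 3) {f : R} (h : ¬ IsTiePosition R f) (m : ℕ) : jFlatT R f m = jFlatE R f m :=
  jFlatT_eq_jFlatE_of_topStratumPrime_eq R f (topStratumPrime_iotaOrdEpsTau_eq_of_not_isTiePosition hdim h) m

/-- At a tie position an attaining flag's filtration lies in `J₃ᵗ`. [OURS · (o37) v1.3] -/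
theorem flagContactFiltration_le_jFlatT_of_isTiePosition (R : Type) [CommRing R] [IsLocalRing R] {f : R} (h : IsTiePosition R f)
    {g₁ g₂ : R} {q r₁ r₂ : ℕ} (hmax : IsSigmaMaximiser f (adicOrder f).toNat g₁ g₂ q r₁ r₂) (hprim : IsPrimitiveTriple q r₁ r₂) (m : ℕ) :
    flagContactFiltration g₁ g₂ q r₁ r₂ m ≤ jFlatT R f m := by
  rw [jFlatT_eq_jSigmaPt_of_isTiePosition R h m]
  exact flagContactFiltration_le_jSigmaPt R h.ne_zero
    (fun hu => mem_nonunits_iff.mp ((mem_maximalIdeal f).mp h.mem_maximalIdeal) hu) hmax hprim m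

/-! ## (P3t-drop) of record and the (o42) target -/

/-- [OURS · (P3t-drop) · candidate · conjecture-grade] **The TIE instance of the point-centre drop statement**, parametric in the tameness cut
and the invariant: `P3tDropOf Tame ι p := PointDropOf (fun R _ _ f => IsTiePosition R f) Tame ι p` — at every TIE position (res-type-092's
`IsTiePosition`: regular local of dimension 3, ε = 0, curve top (ν ; ε)-stratum, a tie presentation) the weighted blow-up of the exact
σ-flag point centre `(x, g₂, g₁; q, r₂, r₁)` (σ-maximiser flag, primitive weights) satisfies the (drop) conjunct for `ι`.  IOTA3-DESIGN v1.3
§8.4 row TIE: «TAME ⇒ ATW transplant (twin of (P3b-drop))». -/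
def P3tDropOf (Tame : (R : Type) → [CommRing R] → R → Prop) (ι : (R : Type) → [CommRing R] → R → Ordinal.{0}) (p : ℕ) : Prop :=
  PointDropOf (fun R _ _ f => IsTiePosition R f) Tame ι p

/-- `P3tDropOf` unfolded. [folklore] -/
theorem p3tDropOf_iff (Tame : (R : Type) → [CommRing R] → R → Prop) (ι : (R : Type) → [CommRing R] → R → Ordinal.{0}) (p : ℕ) :
    P3tDropOf Tame ι p ↔ PointDropOf (fun R _ _ f => IsTiePosition R f) Tame ι p :=
  Iff.rfl

/-- [OURS · (P3t-drop) · candidate · OF RECORD] **(P3t-drop) over the invariant of record `ι₃ᵗ = iotaFlatT`**, parametric only in the tameness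
cut: `P3tDrop Tame p := P3tDropOf Tame iotaFlatT p`. -/
def P3tDrop (Tame : (R : Type) → [CommRing R] → R → Prop) (p : ℕ) : Prop :=
  P3tDropOf Tame iotaFlatT p

/-- `P3tDrop` unfolded. [folklore] -/
theorem p3tDrop_iff (Tame : (R : Type) → [CommRing R] → R → Prop) (p : ℕ) : P3tDrop Tame p ↔ P3tDropOf Tame iotaFlatT p := Iff.rfl

/-- [OURS · (P3t-drop) · candidate · OF RECORD (RULING gen 11 #4 (7))] **(P3t-drop) under the weight-tameness cut (t2)**:
`PointDropOf (fun R _ _ f => IsTiePosition R f) (WeightTame p) iotaFlatT p`. -/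
def P3tDropWeightTame (p : ℕ) : Prop :=
  P3tDrop (WeightTame p) p

/-- `P3tDropWeightTame p` IS the registrar's text of record `PointDropOf (fun R _ _ f => IsTiePosition R f) (WeightTame p) iotaFlatT p`
(definitional). [folklore] -/
theorem p3tDropWeightTame_iff (p : ℕ) :
    P3tDropWeightTame p ↔ PointDropOf (fun R _ _ f => IsTiePosition R f) (WeightTame p) iotaFlatT p :=
  Iff.rfl

/-- [OURS · (o42) target · candidate · conjecture-grade] **The tame POINT-CENTRE drop over `ι₃ᵗ`** (DEALS gen 11 #2, ORDER (o42)): the drop at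
every ε = 0 point-centre position of dimension 3 — ISOLATED (res-type-073's `IsIsolatedPosition`) or TIE — parametric in the tameness cut:
`P3PointDrop Tame p := PointDropOf (fun R _ _ f => IsIsolatedPosition R f ∨ IsTiePosition R f) Tame iotaFlatT p`. -/
def P3PointDrop (Tame : (R : Type) → [CommRing R] → R → Prop) (p : ℕ) : Prop :=
  PointDropOf (fun R _ _ f => IsIsolatedPosition R f ∨ IsTiePosition R f) Tame iotaFlatT p

/-- **The (o42) target splits into its two rows**: `P3PointDrop Tame p ↔ P3bDropOf Tame iotaFlatT p ∧ P3tDrop Tame p`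
(`PointDropOf.union` / `.of_union_left` / `.of_union_right`). [folklore] -/
theorem p3PointDrop_iff (Tame : (R : Type) → [CommRing R] → R → Prop) (p : ℕ) :
    P3PointDrop Tame p ↔ P3bDropOf Tame iotaFlatT p ∧ P3tDrop Tame p :=
  ⟨fun h => ⟨(p3bDropOf_iff_pointDropOf Tame iotaFlatT p).mpr h.of_union_left, h.of_union_right⟩,
    fun h => PointDropOf.union ((p3bDropOf_iff_pointDropOf Tame iotaFlatT p).mp h.1) h.2⟩

namespace P3tDropOf

variable {Tame Tame' : (R : Type) → [CommRing R] → R → Prop} {ι : (R : Type) → [CommRing R] → R → Ordinal.{0}} {p : ℕ}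

/-- A STRONGER tameness cut gives a WEAKER statement. [folklore] -/
theorem mono_tame (hT : ∀ (R : Type) [CommRing R] (g : R), Tame' R g → Tame R g) (h : P3tDropOf Tame ι p) : P3tDropOf Tame' ι p :=
  PointDropOf.mono_tame hT h

/-- Modus ponens at a tie position: the (drop) conjunct text for the exact-flag-weight centre. [folklore] -/
theorem drop (h : P3tDropOf Tame ι p) (k₀ : Type) [Field k₀] [CharP k₀ p] [PerfectField k₀]
    (S : Type) [CommRing S] [Algebra k₀ S] [Algebra.EssFiniteType k₀ S] [IsRegularLocalRing S] (f : S)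
    (hdim : ringKrullDim S ≤ 3) (hf0 : f ≠ 0) (hf2 : f ∈ (maximalIdeal S) ^ 2) (hpos : IsTiePosition S f) (htame : Tame S f)
    {ν : ℕ} (hν : iotaOrd S f = ν) {x g₁ g₂ : S} {q r₁ r₂ : ℕ}
    (hspan : Ideal.span {x, g₂, g₁} = maximalIdeal S) (hrk : (maximalIdeal S).spanFinrank = 3)
    (hmax : IsSigmaMaximiser f ν g₁ g₂ q r₁ r₂) (hprim : IsPrimitiveTriple q r₁ r₂) :
    WeightedDrop ι S f (maximalIdeal S) ![x, g₂, g₁] ![q, r₂, r₁] :=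
  PointDropOf.drop h k₀ S f hdim hf0 hf2 hpos htame hν hspan hrk hmax hprim

end P3tDropOf

namespace P3tDrop

variable {Tame Tame' : (R : Type) → [CommRing R] → R → Prop} {p : ℕ}

/-- A STRONGER tameness cut gives a WEAKER statement. [folklore] -/
theorem mono_tame (hT : ∀ (R : Type) [CommRing R] (g : R), Tame' R g → Tame R g) (h : P3tDrop Tame p) : P3tDrop Tame' p :=
  PointDropOf.mono_tame (Pos := fun R _ _ f => IsTiePosition R f) hT h

/-- The centre of (P3t-drop) IS `J₃ᵗ`'s: at a dimension-3, ε ≠ 1 point-centre position of `(ν ; ε ; τ)` (every tie position is one —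
res-type-013's (o40) 2/2) the attaining flag's filtration lies in `jFlatT S f` (the (pres)/(adm) side of the (c9′) witness is `jSigmaPt`'s).
[folklore] -/
theorem centre_le_jFlatT (S : Type) [CommRing S] [IsLocalRing S] {f : S} (hf0 : f ≠ 0) (hfu : ¬ IsUnit f)
    (h : ContactCylinder.topStratumPrime iotaOrdEpsTau S f = maximalIdeal S) (hdim : ¬ ringKrullDim S ≤ 2) (hε : iotaEps S f ≠ 1)
    {g₁ g₂ : S} {q r₁ r₂ : ℕ} (hmax : IsSigmaMaximiser f (adicOrder f).toNat g₁ g₂ q r₁ r₂) (hprim : IsPrimitiveTriple q r₁ r₂) (m : ℕ) :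
    flagContactFiltration g₁ g₂ q r₁ r₂ m ≤ jFlatT S f m :=
  flagContactFiltration_le_jFlatT S hf0 hfu h hdim hε hmax hprim m

/-- The centre of (P3t-drop) IS `J₃ᵗ`'s at a tie position. [folklore] -/
theorem centre_le_jFlatT_of_isTiePosition (S : Type) [CommRing S] [IsLocalRing S] {f : S} (h : IsTiePosition S f)
    {g₁ g₂ : S} {q r₁ r₂ : ℕ} (hmax : IsSigmaMaximiser f (adicOrder f).toNat g₁ g₂ q r₁ r₂) (hprim : IsPrimitiveTriple q r₁ r₂) (m : ℕ) :
    flagContactFiltration g₁ g₂ q r₁ r₂ m ≤ jFlatT S f m :=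
  flagContactFiltration_le_jFlatT_of_isTiePosition S h hmax hprim m

end P3tDrop

namespace P3PointDrop

variable {Tame Tame' : (R : Type) → [CommRing R] → R → Prop} {p : ℕ}

/-- A STRONGER tameness cut gives a WEAKER statement. [folklore] -/
theorem mono_tame (hT : ∀ (R : Type) [CommRing R] (g : R), Tame' R g → Tame R g) (h : P3PointDrop Tame p) : P3PointDrop Tame' p :=
  PointDropOf.mono_tame (Pos := fun R _ _ f => IsIsolatedPosition R f ∨ IsTiePosition R f) hT h

/-- The isolated row of the (o42) target. [folklore] -/
theorem p3bDropOf (h : P3PointDrop Tame p) : P3bDropOf Tame iotaFlatT p := ((p3PointDrop_iff Tame p).mp h).1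

/-- The tie row of the (o42) target. [folklore] -/
theorem p3tDrop (h : P3PointDrop Tame p) : P3tDrop Tame p := ((p3PointDrop_iff Tame p).mp h).2

/-- The two rows give the (o42) target. [folklore] -/
theorem of_rows (hb : P3bDropOf Tame iotaFlatT p) (ht : P3tDrop Tame p) : P3PointDrop Tame p := (p3PointDrop_iff Tame p).mpr ⟨hb, ht⟩

end P3PointDrop

end Iota3

end Summit.ResolutionOfSingularities.ResolutionOfSingularities.Cruxes.HypersurfaceCentreConstruction.LocalEngine

end
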